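import Summits.QuantumFields.YangMills.Theorems.FlatTubeReductionKineticDefectSlowShift
import HarnessLib

/-!
# The three-step amplitude bootstrap: on `{kinDefect U V g ≤ D}` with a colour-pinned gauge field, the amplitude of `g` is `≲ L(√D + b) + ε + L³a³` even when the link
# amplitude `a` of `U` is only `≍ δ₁` (not `β^{-1/2}`)
# (tool for the tails AT `u` of the log-free moment machine; route `FlatTubeReduction`, crux K1 `NearFlatRatioLaw` stmt-QuantumFields-24720; seat `ym-line-ftr-p1` g12;
# rate twin «ratepack-v3 / frozen fibres»; R2b1 RECORD rung — no summit statement is proved here)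

WHY (memo `Cruxes/NearFlatRatioLaw/Lines/ratepack-v3-frozen-g12.md` §5.8).  To put the `u`-core inside the `1`-core (`…KineticDefectSlowShift.kinDefect_orthoTube_slow_ge` needs
`amp(g)` small) one bounds jumps from the defect (`jump ≤ √D + 2a·amp + b`, lane A's `norm_edgeDefect_ge`) and amplitudes from jumps (`amp ≤ 9L·jump + ε` under colour pinning, lane A's
`norm_su2Quat_sub_one_le_of_jumps`); with `a ≍ δ₁ = β^{-1/6}` one pass gives `amp ≍ Lδ₁`, and each further pass gains a factor `18La`: after three passes the `a`-junk is `(18La)²·36La ≍ L³δ₁³ =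
L³β^{-1/2}` — at the kinetic scale.
* `jump_le_of_kinDefect_le_of_amp` — `kinDefect ≤ D`, `‖q(U_e) − 1‖ ≤ a`, `‖q(U_e) − q(V_e)‖ ≤ b`, `amp(g) ≤ A` ⇒ jumps `≤ √D + 2aA + b`;
* `amp_step` — one pass: the above + colour pinning (`3L·(√D + 2aA + b) < 1`) ⇒ `amp(g) ≤ 9L(√D + 2aA + b) + ε`;
* ★★ `amp_bootstrap_three` — `amp(g) ≤ (9L(√D + b) + ε)(1 + θ + θ²) + θ²·36La`, `θ = 18La`, assuming only the FIRST-pass smallness `3L(√D + 4a + b) < 1` and `9L(√D + 4a + b) + ε ≤ 2`.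
HONEST FRAMING: quaternion bookkeeping; femto rung R2b1 (RECORD label); not infinite volume, not a gap, not Clay.  No defs, no named facts, no `sorry`.
-/

set_option autoImplicit false

noncomputable section

open MeasureTheory Filter Topology Real Set
open scoped BigOperators Quaternion
open Literature.MathematicalPhysics.QuantumFieldTheory
open Literature.MathematicalPhysics.QuantumLattice

namespace Summit.QuantumFields.YangMills.Theorems.FemtoTransferGap.RateTube

open Summit.QuantumFields.YangMills.Theorems.FemtoTransferGap
open Summit.QuantumFields.YangMills.Theorems.FemtoTransferGap.TwoLattice
open Summit.QuantumFields.YangMills.Theorems.FemtoTransferGap.TwoLattice.ConstTube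
open Summit.QuantumFields.YangMills.Theorems.FemtoTransferGap.TwoLattice.Avg

variable {L : ℕ} [NeZero L]

/-- **Jumps from the defect, given an amplitude bound**: `kinDefect U V g ≤ D`, `‖q(U_e) − 1‖ ≤ a`, `‖q(U_e) − q(V_e)‖ ≤ b`, `‖q(g_x) − 1‖ ≤ A` ⇒ every jump `≤ √D + 2aA + b`. [folklore] -/
theorem jump_le_of_kinDefect_le_of_amp (U V : GaugeConfig 3 L SU2) (g : Site 3 L → SU2) {a b D A : ℝ} (ha : ∀ e, ‖su2Quat (U e) - 1‖ ≤ a)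
    (hb : ∀ e, ‖su2Quat (U e) - su2Quat (V e)‖ ≤ b) (hD : kinDefect L U V g ≤ D) (hA : ∀ x, ‖su2Quat (g x) - 1‖ ≤ A) (e : Edge 3 L) :
    ‖su2Quat (g (e.1.shift e.2)) - su2Quat (g e.1)‖ ≤ Real.sqrt D + 2 * a * A + b := by
  have h1 := norm_edgeDefect_ge (U e) (V e) (g e.1) (g (e.1.shift e.2))
  have h2 : ‖su2Quat (U e) * su2Quat (g (e.1.shift e.2)) - su2Quat (g e.1) * su2Quat (V e)‖ ≤ Real.sqrt D := by
    have h := (sq_edgeDefect_le_kinDefect U V g e).trans hD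
    rw [← Real.sqrt_sq (norm_nonneg (su2Quat (U e) * su2Quat (g (e.1.shift e.2)) - su2Quat (g e.1) * su2Quat (V e)))]
    exact Real.sqrt_le_sqrt h
  have ha0 : 0 ≤ a := (norm_nonneg _).trans (ha e)
  have h3 : ‖su2Quat (U e) - 1‖ * ‖su2Quat (g e.1) - 1‖ ≤ a * A := mul_le_mul (ha e) (hA _) (norm_nonneg _) ha0
  linarith [hb e]

/-- **One bootstrap pass**: the above with colour pinning `colourMean g ∈ fpBall ε` and `3L(√D + 2aA + b) < 1` ⇒ `amp(g) ≤ 9L(√D + 2aA + b) + ε`. [folklore] -/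
theorem amp_step (U V : GaugeConfig 3 L SU2) {g : Site 3 L → SU2} {a b D A ε : ℝ} (ha : ∀ e, ‖su2Quat (U e) - 1‖ ≤ a) (hb : ∀ e, ‖su2Quat (U e) - su2Quat (V e)‖ ≤ b)
    (hD : kinDefect L U V g ≤ D) (hA : ∀ x, ‖su2Quat (g x) - 1‖ ≤ A) (hsmall : 3 * L * (Real.sqrt D + 2 * a * A + b) < 1) (hW : colourMean L g ∈ fpBall ε) (x : Site 3 L) :
    ‖su2Quat (g x) - 1‖ ≤ 9 * L * (Real.sqrt D + 2 * a * A + b) + ε :=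
  norm_su2Quat_sub_one_le_of_jumps (L := L) (jump_le_of_kinDefect_le_of_amp U V g ha hb hD hA) hsmall hW x

/-- ★★ **THREE-STEP BOOTSTRAP.**  `kinDefect U V g ≤ D`, `‖q(U_e) − 1‖ ≤ a`, `‖q(U_e) − q(V_e)‖ ≤ b`, colour pinning `colourMean g ∈ fpBall ε`, and the FIRST-pass smallness
`3L(√D + 4a + b) < 1`, `9L(√D + 4a + b) + ε ≤ 2`.  Then with `θ = 18La`, `P = 9L(√D + b) + ε`:  `amp(g) = max_x ‖q(g_x) − 1‖ ≤ P(1 + θ + θ²) + θ²·36La`. [folklore] -/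
theorem amp_bootstrap_three (U V : GaugeConfig 3 L SU2) {g : Site 3 L → SU2} {a b D ε : ℝ} (ha : ∀ e, ‖su2Quat (U e) - 1‖ ≤ a) (hb : ∀ e, ‖su2Quat (U e) - su2Quat (V e)‖ ≤ b)
    (hD : kinDefect L U V g ≤ D) (hW : colourMean L g ∈ fpBall ε) (hsmall : 3 * L * (Real.sqrt D + 4 * a + b) < 1)
    (htwo : 9 * L * (Real.sqrt D + 4 * a + b) + ε ≤ 2) (x : Site 3 L) :
    ‖su2Quat (g x) - 1‖ ≤ (9 * L * (Real.sqrt D + b) + ε) * (1 + 18 * L * a + (18 * L * a) ^ 2) + (18 * L * a) ^ 2 * (36 * L * a) := by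
  have ha0 : 0 ≤ a := (norm_nonneg _).trans (ha default)
  have hb0 : 0 ≤ b := (norm_nonneg _).trans (hb default)
  have hL0 : (0 : ℝ) ≤ L := Nat.cast_nonneg _
  have hD0 : 0 ≤ Real.sqrt D := Real.sqrt_nonneg _
  -- pass 0: the trivial amplitude `2`
  have hA0 : ∀ y, ‖su2Quat (g y) - 1‖ ≤ 2 := fun y => (norm_sub_le _ _).trans (by rw [norm_su2Quat, norm_one]; norm_num)
  -- pass 1
  have hs1 : 3 * L * (Real.sqrt D + 2 * a * 2 + b) < 1 := by nlinarith
  have hA1 : ∀ y, ‖su2Quat (g y) - 1‖ ≤ 9 * L * (Real.sqrt D + 2 * a * 2 + b) + ε := amp_step U V ha hb hD hA0 hs1 hW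
  set A1 : ℝ := 9 * L * (Real.sqrt D + 2 * a * 2 + b) + ε with hA1def
  have hA1le : A1 ≤ 2 := by rw [hA1def]; nlinarith
  have hA1nn : 0 ≤ A1 := (norm_nonneg _).trans (hA1 x)
  -- pass 2
  have hs2 : 3 * L * (Real.sqrt D + 2 * a * A1 + b) < 1 := by
    have : 2 * a * A1 ≤ 2 * a * 2 := by nlinarith
    nlinarith
  have hA2 : ∀ y, ‖su2Quat (g y) - 1‖ ≤ 9 * L * (Real.sqrt D + 2 * a * A1 + b) + ε := amp_step U V ha hb hD hA1 hs2 hW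
  set A2 : ℝ := 9 * L * (Real.sqrt D + 2 * a * A1 + b) + ε with hA2def
  have hA2le : A2 ≤ 2 := by
    rw [hA2def]
    have : 2 * a * A1 ≤ 2 * a * 2 := by nlinarith
    nlinarith
  -- pass 3
  have hs3 : 3 * L * (Real.sqrt D + 2 * a * A2 + b) < 1 := by
    have : 2 * a * A2 ≤ 2 * a * 2 := by nlinarith
    nlinarith
  have hA3 := amp_step U V ha hb hD hA2 hs3 hW x
  -- algebra: `A3 = P + θ A2`, `A2 = P + θ A1`, `A1 = P + 36La`
  have e1 : A1 = (9 * L * (Real.sqrt D + b) + ε) + 36 * L * a := by rw [hA1def]; ring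
  have e2 : A2 = (9 * L * (Real.sqrt D + b) + ε) + 18 * L * a * A1 := by rw [hA2def]; ring
  have e3 : 9 * L * (Real.sqrt D + 2 * a * A2 + b) + ε = (9 * L * (Real.sqrt D + b) + ε) + 18 * L * a * A2 := by ring
  rw [e3] at hA3
  rw [e2, e1] at hA3
  have e4 : (9 * L * (Real.sqrt D + b) + ε) + 18 * L * a * ((9 * L * (Real.sqrt D + b) + ε) + 18 * L * a * ((9 * L * (Real.sqrt D + b) + ε) + 36 * L * a)) =
      (9 * L * (Real.sqrt D + b) + ε) * (1 + 18 * L * a + (18 * L * a) ^ 2) + (18 * L * a) ^ 2 * (36 * L * a) := by ring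
  rw [e4] at hA3
  exact hA3

end Summit.QuantumFields.YangMills.Theorems.FemtoTransferGap.RateTube

end
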